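import Literature.Barriers.HodgeConjecture.KaehlerCoherentSheavesWeilClassProofs
import Literature.Geometry.Kaehler.ComplexTorusWeilNeronSeveri
import Literature.Geometry.Kaehler.ComplexTorusHodgeDecomposition
import HarnessLib

/-!
# Voisin's Weil torus: the barrier fact assembled from de Rham's theorem and the absence of subvarieties

Final file of the discharge programme of the barrier fact
`Literature.Barriers.HodgeConjecture.Voisin2002_weilTorus_hodgeClassWithoutSubvarieties`
(`KaehlerCoherentSheaves.lean`; programme in `KaehlerCoherentSheavesProofs.lean`). The witness is
the EXPLICIT complex torus of Weil type `X = ℂ⁴/Φ(ℤ⁸)`, `Φ = Weil.periodEquiv`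
(`Literature/Geometry/Kaehler/ComplexTorusWeilPeriod.lean`: transcendental period `t`, a lattice of
Weil type for `J = diag(i, i, -i, -i)`), a compact connected Kähler `4`-fold charted on `ℂ⁴`
(flat metric, `ComplexTorus.instIsKaehlerManifold`). Of the three clauses of
`VoisinWeilTorusWitness (Fin 4 → ℂ)`:

* (c) a non-zero rational class of type `(2,2)` in `H⁴(X; ℂ)` — PROVED from de Rham's theorem
  (`exists_isRationalClass_weilClass`, file `KaehlerCoherentSheavesWeilClassProofs`);
* (a) `NS(X) = 0`: every integral class of type `(1,1)` in `H²(X; ℂ)` vanishes — PROVED from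
  de Rham's theorem here (`neronSeveri_eq_zero_weilTorus`): a `(1,1)`-class transported through a
  natural comparison family is the class of an invariant `(1,1)`-form `γ` (Hodge decomposition of
  the torus, `ComplexTorus.cavgClass_mem_typeSubmodule`); an integral class is rational, so
  `γ = g γ₀` with `γ₀` a rational invariant form (`exists_smul_mem_span_coordForm_of_isRationalClass`,
  naturality + universal coefficients), `γ₀` is again `i`-invariant, hence `γ₀ = 0` by the
  transcendence computation `Weil.eq_zero_of_mem_span_coordForm_of_smul_I` (`NS_ℚ = 0`);
* (b) every closed analytic subset `Z ≠ X` is finite — Voisin's §3 argument ("assumption (b)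
  will be a consequence of assumption (a) and of the fact that `X` is simple": a positive-
  dimensional proper subvariety of a simple torus has positive canonical bundle and generates the
  torus, making it algebraic, contradicting `NS(X) = 0`; Ueno's structure theory of subvarieties
  of complex tori) is NOT in the tree and is the hypothesis `h₂`.

So `Voisin2002_weilTorus_hodgeClassWithoutSubvarieties_of_leaves` ASSEMBLES the fact from exactly
two leaves: (1) de Rham's theorem with complex coefficients on `ℂ⁴`-charted manifolds — the named
fact `exists_complexDeRhamIsoFamily (Fin 4 → ℂ)`, which the fact implies back
(`Voisin2002_weilTorus_hodgeClassWithoutSubvarieties.exists_complexDeRhamIsoFamily`); (2) the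
absence of positive-dimensional proper closed analytic subsets in the explicit torus `X`
(Voisin §2 (b) for this `X`). On the truth of leaf (2): Voisin derives (b) from `NS(X) = 0` and
the simplicity of `X` (§3, after Prop. 3); `NS(X) = 0` is proved here, and `X` is simple because a
rational subspace of `Γ_ℚ` stable under the complex structure `I_t = Φ_t⁻¹ ∘ i ∘ Φ_t` for the
transcendental `t` would be stable under `I_{t'}` for every admissible rational `t'` (polynomial
identities in `t`), whereas already `I_2, I_3, I_5` generate the full commutant `M₄(ℚ(i))` of the
`ℤ[I]`-action, which acts irreducibly on `Γ_ℚ = ℚ(i)⁴` (an exact linear-algebra check, not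
formalised here).

No definition and no named fact is introduced.

## References

* C. Voisin, IMRN 2002 no. 20, 1057–1075 (arXiv:math/0112247), Thm. 1, §2 (a)–(b), §3 Prop. 3
  and the simplicity argument following it. [Voisin2002KaehlerCounterexample]
* K. Ueno, *Classification Theory of Algebraic Varieties and Compact Complex Spaces*, LNM 439
  (1975), §10 (subvarieties of complex tori) — the source of leaf (2). [cited through Voisin §3]
-/

noncomputable section

open scoped Manifold ContDiff Topology ComplexConjugate

namespace Literature.Barriers.HodgeConjecture

open Literature.AlgebraicGeometry.HodgeTheory Literature.AlgebraicTopology.SingularHomology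
  Literature.NumberTheory.Transcendental Literature.Geometry.Kaehler singularCochainComplex

/-! ### Clause (a): `NS(X) = 0` for the explicit Weil torus -/

/-- An invariant form of type `(1,1)` is `i`-invariant: `γ(iu, iv) = γ(u, v)` (the rotation
`e^{iθ}` with `θ = π/2`). [cite: Voisin2002, §2.3.1] -/
theorem apply_I_smul_of_isConstOfType {E : Type*} [NormedAddCommGroup E] [NormedSpace ℂ E]
    {γ : E [⋀^Fin 2]→L[ℝ] ℂ} (h : ComplexTorus.IsConstOfType 1 1 γ) (u v : E) :
    γ ![Complex.I • u, Complex.I • v] = γ ![u, v] := by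
  have h2 := h.2 (Real.pi / 2) ![u, v]
  have hexp : Complex.exp (((Real.pi / 2 : ℝ) : ℂ) * Complex.I) = Complex.I := by
    rw [show (((Real.pi / 2 : ℝ) : ℂ) * Complex.I) = Real.pi / 2 * Complex.I by push_cast; ring]
    exact Complex.exp_pi_div_two_mul_I
  rw [hexp] at h2
  have hv : (fun i : Fin 2 ↦ Complex.I • (![u, v] : Fin 2 → E) i) = ![Complex.I • u, Complex.I • v] := by
    funext i; fin_cases i <;> rfl
  rw [hv] at h2
  rw [h2]
  norm_num

/-- **Clause (a) of Voisin's witness for the explicit Weil torus: `NS(X) = 0`.** Every integral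
class of type `(1,1)` in `H²(X; ℂ)`, `X = ℂ⁴/Φ(ℤ⁸)`, `Φ = Weil.periodEquiv`, vanishes (for the
`∃`-convention of `IsOfTypeOnManifold`: through whichever natural comparison family).
Voisin (2002), §3 Prop. 3 (i) (`NS(X) = 0` for general `X` of Weil type), here for the explicit
very general member. [cite: Voisin2002KaehlerCounterexample, §2 (a) and §3 Prop. 3] -/
theorem neronSeveri_eq_zero_weilTorus
    (c : singularCohomology ℂ ℂ (ComplexTorus Weil.periodEquiv) 2) (hc : IsIntegralClass c)
    (ht : IsOfTypeOnManifold (E := Fin 4 → ℂ) 2 1 1 c) : c = 0 := by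
  obtain ⟨e, he, x, hx, rfl⟩ := ht
  -- `x` is the class of the invariant `(1,1)`-form `γ = avg x`
  set γ := ComplexTorus.cavgClass Weil.periodEquiv x with hγ
  have hxγ : x = ComplexTorus.cconstClass Weil.periodEquiv γ :=
    (ComplexTorus.cconstClass_cavgClass Weil.periodEquiv x).symm
  have hγtype : ComplexTorus.IsConstOfType 1 1 γ :=
    (ComplexTorus.isConstOfType_iff_isOfTypeAt γ).2
      (Literature.Analysis.Complex.isOfTypeAt_of_mem_typeSubmodule rfl
        (ComplexTorus.cavgClass_mem_typeSubmodule Weil.periodEquiv hx))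
  -- `γ = g γ₀` with `γ₀` a rational invariant form
  have hrat : IsRationalClass (e (ComplexTorus Weil.periodEquiv) 2
      (ComplexTorus.cconstClass Weil.periodEquiv γ)) := by
    rw [← hxγ]; exact hc.isRationalClass
  obtain ⟨g, γ₀, hγ₀, hgγ⟩ :=
    exists_smul_mem_span_coordForm_of_isRationalClass Weil.periodEquiv he γ hrat
  -- `γ₀ = 0` unless `g = 0`; in both cases `γ = 0`
  have hγ0 : γ = 0 := by
    by_cases hg : g = 0
    · rw [hgγ, hg]; ext v; simp
    · have h11 : ∀ u v : Fin 4 → ℂ, γ₀ ![Complex.I • u, Complex.I • v] = γ₀ ![u, v] := fun u v ↦ by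
        have h1 := apply_I_smul_of_isConstOfType hγtype u v
        rw [hgγ, ContinuousAlternatingMap.smul_apply, ContinuousAlternatingMap.smul_apply] at h1
        exact (smul_right_injective ℂ hg) h1
      rw [hgγ, Weil.eq_zero_of_mem_span_coordForm_of_smul_I γ₀ hγ₀ h11]; ext v; simp
  change (e (ComplexTorus Weil.periodEquiv) 2).toLinearMap x = 0
  rw [hxγ, hγ0, map_zero, map_zero]

/-! ### Assembly -/

/-- **Voisin's counterexample, assembled from its two leaves.** Let `X = ℂ⁴/Φ(ℤ⁸)` be the explicit
complex torus of Weil type (`Φ = Weil.periodEquiv`). ASSUME (leaf 1) de Rham's theorem with complex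
coefficients for manifolds charted on `ℂ⁴` (the named fact `exists_complexDeRhamIsoFamily (Fin 4 → ℂ)`,
implied back by the fact) and (leaf 2) that every closed analytic subset `Z ≠ X` of `X` is finite
(Voisin's §2 (b) for `X`: "a consequence of assumption (a) and of the fact that `X` is simple", via
the structure of subvarieties of complex tori — not in the tree). THEN the barrier fact holds with
witness `X`: clauses (a) (`neronSeveri_eq_zero_weilTorus`) and (c)
(`exists_isRationalClass_weilClass`) are PROVED. [cite: Voisin2002KaehlerCounterexample, Thm. 1, §2 (a)–(b), §3 Prop. 3] -/
theorem Voisin2002_weilTorus_hodgeClassWithoutSubvarieties_of_leaves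
    (h₁ : exists_complexDeRhamIsoFamily (Fin 4 → ℂ))
    (h₂ : ∀ Z : Set (ComplexTorus Weil.periodEquiv),
      IsAnalyticSet 𝓘(ℂ, Fin 4 → ℂ) Z → Z ≠ Set.univ → Z.Finite) :
    Voisin2002_weilTorus_hodgeClassWithoutSubvarieties := by
  classical
  obtain ⟨e, he⟩ := h₁
  obtain ⟨cls, h1, h2, h3⟩ := exists_isRationalClass_weilClass (Φ := Weil.periodEquiv)
    (A := Weil.rotMatrix) Weil.periodEquiv_rotMatrix he
  exact ⟨{ carrier := ComplexTorus Weil.periodEquiv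
           isKaehlerManifold := inferInstance
           neronSeveri_eq_zero := neronSeveri_eq_zero_weilTorus
           finite_of_isAnalyticSet := h₂
           cls := cls
           isRationalClass := h1
           cls_ne_zero := h2
           isOfType := h3 }⟩

end Literature.Barriers.HodgeConjecture

end
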